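import Literature.NumberTheory.Sieve.FordMaynardTweak

/-!
# Route `FordMaynardNoSieveConst0164`, crux `NegWitness0164` (stmt-Parity-19102), line `birth`,
# stub `stub_tweakNeg0164`: the fsl-extension with the EMPTY bad family — reduction lemmas

First helper file toward the certificate stub `stub_tweakNeg0164` (K. Ford, J. Maynard, *On the theory of
prime producing sieves*, arXiv:2407.14368, Theorem 2.7 at `P = (1/2, 0, ν₀)`, `ν₀ = 41/250`; the stub asks for
raw simplex data `F₀` whose extension `h = tweak (1/2) (41/250) Fin.elim0 Fin.elim0 F₀` has `h(1) < -1` and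
`h ≥ -1` in every dimension `≥ 2`).  Def-free bookkeeping valid for ANY raw data `F₀`, which every replay of
the certificate (cell LP optimum `fspec_41_250_m24.json`, or any other witness of the same shape) starts from:

* `not_badSubsum_elim0`, `tweakData_elim0` — with the empty family of bad windows (`L = 0`) nothing is cut:
  `tweakData Fin.elim0 Fin.elim0 f = f`;
* `tweak_elim0_apply`, `tweak_elim0_of_mem`, `tweak_elim0_of_not_mem`, `tweak_elim0_of_small` — the
  extension is `𝟙[ξᵢ ≥ η, Σ ξ = 1] · fragOp γ η f`, and equals the raw data at vectors with all components in
  `[η, 1 - γ)` (Lemma 5.5 (b), `fragOp_apply_of_small`);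
* `large_unique`, `exists_large_two` — for `γ ≤ 1/2` a vector of the support of dimension `≥ 3` has at
  most one component `≥ 1 - γ`, and (γ = 1/2) a vector of dimension `2` on the simplex has one `≥ 1/2`;
* `le_tweak_elim0_of` — **the reduction**: a uniform lower bound `c ≤ 0` for `h` in all dimensions follows
  from `c ≤ F₀` at the small vectors of the support and `c ≤ fragOp γ η F₀` at the vectors of the support
  with a component `≥ 1 - γ` and dimension `≤ 1/η`;
* `tweak_one_eq_fragOp_0164`, `stub_lower_of_0164` — the two clauses of `stub_tweakNeg0164` restated through
  `fragOp (1/2) (41/250) F₀`: `h 1 1 = fragOp … 1 1`, and `h ≥ -1` in dimensions `≥ 2` follows from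
  `F₀ ≥ -1` on small vectors plus `fragOp … F₀ ≥ -1` at the large-component vectors of dimensions `2, …, 6`.

References: [FordMaynard2024PrimeSieves] arXiv:2407.14368, §6.1 (6.3)/(fsl), §6.2, §8 (proof of Thm 2.7 (c)).
-/

noncomputable section

open Finset
open Literature.NumberTheory.Sieve Literature.NumberTheory.Sieve.FordMaynard

namespace Summit.Parity.GeneralizedHardyLittlewood.FordMaynardNoSieveConst0164NegWitness0164

variable {γ η : ℝ} {f : VecFn}

/-- With the empty family of bad windows no vector has a bad subsum. [folklore] -/
theorem not_badSubsum_elim0 (k : ℕ) (ξ : Fin k → ℝ) : ¬ BadSubsum Fin.elim0 Fin.elim0 k ξ := by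
  rintro ⟨_, _, _, l, _⟩
  exact l.elim0

/-- `tweakData` with the empty family is the identity: nothing is cut.
[cite: FordMaynard2024PrimeSieves, §9 (ftilde)] -/
theorem tweakData_elim0 (f : VecFn) : tweakData Fin.elim0 Fin.elim0 f = f := by
  funext k ξ
  unfold tweakData
  rw [if_neg (not_badSubsum_elim0 k ξ)]

open scoped Classical in
/-- The extension with the empty family: the support cut-off times `fragOp γ η f` of the RAW data.
[cite: FordMaynard2024PrimeSieves, §6.1 (6.3)] -/
theorem tweak_elim0_apply (γ η : ℝ) (f : VecFn) (k : ℕ) (ξ : Fin k → ℝ) :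
    tweak γ η Fin.elim0 Fin.elim0 f k ξ =
      if (∀ i, η ≤ ξ i) ∧ ∑ i, ξ i = 1 then fragOp γ η f k ξ else 0 := by
  unfold tweak
  rw [tweakData_elim0]

/-- On the support `{ξᵢ ≥ η, Σ ξ = 1}` the extension is `fragOp γ η f (ξ)`.
[cite: FordMaynard2024PrimeSieves, §6.1 (6.3)] -/
theorem tweak_elim0_of_mem {k : ℕ} {ξ : Fin k → ℝ} (h1 : ∀ i, η ≤ ξ i) (hsum : ∑ i, ξ i = 1) :
    tweak γ η Fin.elim0 Fin.elim0 f k ξ = fragOp γ η f k ξ := by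
  rw [tweak_elim0_apply, if_pos ⟨h1, hsum⟩]

/-- Off the support the extension vanishes. [cite: FordMaynard2024PrimeSieves, Definition 6.2 (a)] -/
theorem tweak_elim0_of_not_mem {k : ℕ} {ξ : Fin k → ℝ} (h : ¬ ((∀ i, η ≤ ξ i) ∧ ∑ i, ξ i = 1)) :
    tweak γ η Fin.elim0 Fin.elim0 f k ξ = 0 := by
  rw [tweak_elim0_apply, if_neg h]

/-- **Small vectors**: at a vector of the support with all components `< 1 - γ` the extension IS the raw
data (`0 < η ≤ 1`; Lemma 5.5 (b)). [cite: FordMaynard2024PrimeSieves, §6.1 (remarks after (6.3))] -/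
theorem tweak_elim0_of_small (hη : 0 < η) (hη1 : η ≤ 1) {k : ℕ} {ξ : Fin k → ℝ}
    (h1 : ∀ i, η ≤ ξ i) (h2 : ∀ i, ξ i < 1 - γ) (hsum : ∑ i, ξ i = 1) :
    tweak γ η Fin.elim0 Fin.elim0 f k ξ = f k ξ := by
  rw [tweak_elim0_of_mem h1 hsum, fragOp_apply_of_small hη hη1 f h1 h2]

/-- **At most one large component** (`γ ≤ 1/2`, `η > 0`): a vector of dimension `≥ 3` with components
`≥ η` summing to `1` has at most one component `≥ 1 - γ` (two of them already sum to `≥ 1`).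
[cite: FordMaynard2024PrimeSieves, §8 (proof of Theorem 2.7 (c), the functions f_{s,1})] -/
theorem large_unique (hγ : γ ≤ 1 / 2) (hη : 0 < η) {k : ℕ} {ξ : Fin k → ℝ} (h1 : ∀ i, η ≤ ξ i)
    (hsum : ∑ i, ξ i = 1) (hk : 3 ≤ k) {a b : Fin k} (ha : 1 - γ ≤ ξ a) (hb : 1 - γ ≤ ξ b) :
    a = b := by
  by_contra hab
  have hb' : b ∈ Finset.univ.erase a := Finset.mem_erase.2 ⟨Ne.symm hab, Finset.mem_univ b⟩
  have hsplit : ∑ i, ξ i = ξ a + (ξ b + ∑ i ∈ (Finset.univ.erase a).erase b, ξ i) := by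
    rw [Finset.add_sum_erase _ _ hb', Finset.add_sum_erase _ _ (Finset.mem_univ a)]
  have hcard : ((Finset.univ.erase a).erase b).card = k - 2 := by
    rw [Finset.card_erase_of_mem hb', Finset.card_erase_of_mem (Finset.mem_univ a), Finset.card_univ,
      Fintype.card_fin]
    omega
  have hrest : ((k : ℝ) - 2) * η ≤ ∑ i ∈ (Finset.univ.erase a).erase b, ξ i := by
    calc ((k : ℝ) - 2) * η = ∑ _i ∈ (Finset.univ.erase a).erase b, η := by
          rw [Finset.sum_const, hcard, nsmul_eq_mul, Nat.cast_sub (by omega : 2 ≤ k)]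
          norm_num
      _ ≤ ∑ i ∈ (Finset.univ.erase a).erase b, ξ i := Finset.sum_le_sum fun i _ => h1 i
  have hk' : (3 : ℝ) ≤ k := by exact_mod_cast hk
  have hη' : η ≤ ((k : ℝ) - 2) * η := by nlinarith
  linarith

/-- In dimension `2` a vector on the simplex has a component `≥ 1/2` (the case `γ = 1/2`: every vector of
dimension `2` in the support has a large component). [folklore] -/
theorem exists_large_two (ξ : Fin 2 → ℝ) (hsum : ∑ i, ξ i = 1) : ∃ j, 1 / 2 ≤ ξ j := by
  by_contra h
  push Not at h
  have h0 := h 0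
  have h1 := h 1
  rw [Fin.sum_univ_two] at hsum
  linarith

/-- **The reduction of a uniform lower bound** (one dimension `k` at a time). For `0 < η ≤ 1` and
`c ≤ 0`: if the raw data satisfy `c ≤ f(ξ)` at every `k`-vector of the support with all components `< 1 - γ`,
and `c ≤ fragOp γ η f (ξ)` at every `k`-vector of the support having a component `≥ 1 - γ` (needed only when
`k ≤ 1/η`), then `c ≤ tweak γ η ∅ ∅ f` on all `k`-vectors.
[cite: FordMaynard2024PrimeSieves, §8 (proof of Theorem 2.7 (c): "it remains to show f_{s,1} ≥ -1")] -/
theorem le_tweak_elim0_of (hη : 0 < η) (hη1 : η ≤ 1) {c : ℝ} (hc : c ≤ 0) {k : ℕ}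
    (hsmall : ∀ ξ : Fin k → ℝ, (∀ i, η ≤ ξ i) → (∀ i, ξ i < 1 - γ) → ∑ i, ξ i = 1 → c ≤ f k ξ)
    (hlarge : ∀ ξ : Fin k → ℝ, (k : ℝ) ≤ 1 / η → (∀ i, η ≤ ξ i) → ∑ i, ξ i = 1 →
      (∃ j, 1 - γ ≤ ξ j) → c ≤ fragOp γ η f k ξ)
    (ξ : Fin k → ℝ) : c ≤ tweak γ η Fin.elim0 Fin.elim0 f k ξ := by
  by_cases hmem : (∀ i, η ≤ ξ i) ∧ ∑ i, ξ i = 1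
  · by_cases hk : (k : ℝ) ≤ 1 / η
    · by_cases hlg : ∃ j, 1 - γ ≤ ξ j
      · rw [tweak_elim0_of_mem hmem.1 hmem.2]
        exact hlarge ξ hk hmem.1 hmem.2 hlg
      · push Not at hlg
        rw [tweak_elim0_of_small hη hη1 hmem.1 hlg hmem.2]
        exact hsmall ξ hmem.1 hlg hmem.2
    · rw [tweak_eq_zero_of_lt hη (not_le.1 hk) ξ]
      exact hc
  · rw [tweak_elim0_of_not_mem hmem]
    exact hc

/-! ### The two clauses of `stub_tweakNeg0164` through `fragOp (1/2) (41/250)` -/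

/-- The value at `(1)`: `h 1 1 = fragOp (1/2) (41/250) F₀ (1)` (the vector `(1)` lies in the support).
[cite: FordMaynard2024PrimeSieves, §8 (proof of Theorem 2.7 (c), "f(1) = I₃ + I₅")] -/
theorem tweak_one_eq_fragOp_0164 (F₀ : VecFn) :
    tweak (1 / 2) (41 / 250) Fin.elim0 Fin.elim0 F₀ 1 (fun _ => 1) =
      fragOp (1 / 2) (41 / 250) F₀ 1 (fun _ => 1) :=
  tweak_elim0_of_mem (fun _ => by norm_num) (by simp)

/-- **The lower-bound clause of the stub, reduced**: `h = tweak (1/2) (41/250) ∅ ∅ F₀ ≥ -1` in every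
dimension `≥ 2` follows from (i) `F₀ ≥ -1` at the small vectors of the support (all components in
`[41/250, 1/2)`) and (ii) `fragOp (1/2) (41/250) F₀ ≥ -1` at the vectors of the support of dimensions
`2, …, 6` having a component `≥ 1/2` (dimension `≥ 7` is empty since `7 · 41/250 > 1`; in dimension `≥ 3` that
component is unique, `large_unique`; in dimension `2` there always is one, `exists_large_two`).
[cite: FordMaynard2024PrimeSieves, §8 (proof of Theorem 2.7 (c))] -/
theorem stub_lower_of_0164 {F₀ : VecFn}
    (hsmall : ∀ (k : ℕ) (ξ : Fin k → ℝ), (∀ i, (41 / 250 : ℝ) ≤ ξ i) → (∀ i, ξ i < 1 / 2) →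
      ∑ i, ξ i = 1 → -1 ≤ F₀ k ξ)
    (hlarge : ∀ k : ℕ, 2 ≤ k → k ≤ 6 → ∀ ξ : Fin k → ℝ, (∀ i, (41 / 250 : ℝ) ≤ ξ i) → ∑ i, ξ i = 1 →
      (∃ j, 1 / 2 ≤ ξ j) → -1 ≤ fragOp (1 / 2) (41 / 250) F₀ k ξ) :
    ∀ k : ℕ, 2 ≤ k → ∀ β : Fin k → ℝ, -1 ≤ tweak (1 / 2) (41 / 250) Fin.elim0 Fin.elim0 F₀ k β := by
  intro k hk β
  refine le_tweak_elim0_of (by norm_num) (by norm_num) (by norm_num) ?_ ?_ β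
  · intro ξ h1 h2 hsum
    exact hsmall k ξ h1 (fun i => by linarith [h2 i]) hsum
  · intro ξ hk' h1 hsum hlg
    have hk6 : k ≤ 6 := by
      by_contra h
      have : (7 : ℝ) ≤ k := by exact_mod_cast (by omega : 7 ≤ k)
      norm_num at hk'
      linarith
    exact hlarge k hk hk6 ξ h1 hsum (by obtain ⟨j, hj⟩ := hlg; exact ⟨j, by linarith⟩)

end Summit.Parity.GeneralizedHardyLittlewood.FordMaynardNoSieveConst0164NegWitness0164

end
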